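import Summits.HubbardSuperconductivity.HubbardSuperconductivity.Theorems.AnisotropyChordInsertionEntropyJastrow

/-!
# Route `AnisotropyChord` / H0 rotor rung: the two-defect cloud in terms of UNCONDITIONED truncated correlations,
# (port of theory seat `hubbard-h0-rotor-theory-1`, Sketch9 Part N, generic half, memo ROTOR-THEORY-9 §135(q);
# amplitude-generic, any finite vertex set)

For a real amplitude `a` on hard-core configurations `V → Fin 2` write `μ(σ) = a(σ)²/Z` (`Z = Σ a²`):
* `flipAt x` (occupation flip, an involution) and `sum_template_eq_sum_config`: template sums
  `Σ_{τ : τ x = τ y = 1} g(τ + x)` are configuration sums `Σ_{σ : σ x = 0, σ y = 1} g(σ)`;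
* weighted sums / means `wsum`, `wnorm`, `wmean`, one-point density `dens`, truncated pair correlation `corr2`,
  Ursell three-point function `ucorr3`, particle–hole probability `probPH = μ(n_x(1−n_y)) = a_{xy}/Z`;
* **S4 identity** `condOcc_sub_dens_eq`:
  `P[n_z = 1 | x occupied, y empty] − ρ_z = ((1−ρ_y)c(z,x) − ρ_x c(z,y) − u₃(z,x,y)) / μ(n_x(1−n_y))`
  and **S4 bound** `abs_condOcc_sub_dens_le` (decay of `c`, `u₃` and a particle–hole floor give the R8b cloud bound);
(The covariance toolkit of Part O is `…InsertionEntropySheetCovariance`.)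
-/

set_option linter.dupNamespace false

noncomputable section

open Finset

namespace Summit.HubbardSuperconductivity.HubbardSuperconductivity.Theorems.AnisotropyChord.InsertionEntropy

section SheetCorrelations

variable {V : Type} [Fintype V] [DecidableEq V]

omit [Fintype V] [DecidableEq V] in
/-- In `Fin 2`, `t = 1 ↔ t ≠ 0`. [folklore] -/
theorem fin2_eq_one_iff_ne_zero (t : Fin 2) : t = 1 ↔ t ≠ 0 := by
  constructor
  · rintro rfl; decide
  · intro h; fin_cases t
    · exact absurd rfl h
    · rfl

/-- Flip the occupation at `x`: an involution of configuration space. (theory seat Sketch9 Part N) [folklore] -/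
def flipAt (x : V) : (V → Fin 2) ≃ (V → Fin 2) where
  toFun τ := Function.update τ x (1 - τ x)
  invFun τ := Function.update τ x (1 - τ x)
  left_inv τ := by
    ext u
    by_cases h : u = x
    · subst h; simp
    · simp [h]
  right_inv τ := by
    ext u
    by_cases h : u = x
    · subst h; simp
    · simp [h]

omit [Fintype V] in
/-- Unfolding `flipAt`. [folklore] -/
theorem flipAt_apply (x : V) (τ : V → Fin 2) : flipAt x τ = Function.update τ x (1 - τ x) := rfl

/-- Template sums are configuration sums: `Σ_{τ : τ x = τ y = 1} g(τ + x) = Σ_{σ : σ x = 0, σ y = 1} g(σ)` (`x ≠ y`).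
(theory seat Sketch9 Part N) [folklore] -/
theorem sum_template_eq_sum_config (g : (V → Fin 2) → ℝ) (x y : V) (hxy : x ≠ y) :
    (∑ τ : V → Fin 2, if τ x = 1 ∧ τ y = 1 then g (Function.update τ x 0) else 0)
      = ∑ σ : V → Fin 2, if σ x = 0 ∧ σ y = 1 then g σ else 0 := by
  rw [← Equiv.sum_comp (flipAt x) (fun σ : V → Fin 2 => if σ x = 0 ∧ σ y = 1 then g σ else 0)]
  refine Finset.sum_congr rfl fun τ _ => ?_
  simp only [flipAt_apply]
  have hy : Function.update τ x (1 - τ x) y = τ y := Function.update_of_ne (Ne.symm hxy) _ _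
  have hx : Function.update τ x (1 - τ x) x = 1 - τ x := Function.update_self _ _ _
  rw [hy, hx]
  by_cases h1 : τ x = 1
  · have h10 : (1 : Fin 2) - τ x = 0 := by rw [h1]; decide
    rw [h10]
    simp [h1]
  · have h0 : τ x = 0 := by
      rcases Fin.exists_fin_two.mp ⟨τ x, rfl⟩ with h | h
      · exact h
      · exact absurd h h1
    have h11 : (1 : Fin 2) - τ x = 1 := by rw [h0]; decide
    rw [h11]
    simp [h1]

/-- Weighted (unnormalised) expectation `Σ_σ a(σ)² f(σ)`. (theory seat Sketch9 Part N) [folklore] -/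
def wsum (a : (V → Fin 2) → ℝ) (f : (V → Fin 2) → ℝ) : ℝ := ∑ σ, a σ ^ 2 * f σ

/-- Normalisation `Z = Σ_σ a(σ)²`. (theory seat Sketch9 Part N) [folklore] -/
def wnorm (a : (V → Fin 2) → ℝ) : ℝ := ∑ σ, a σ ^ 2

/-- Expectation in the measure `μ(σ) = a(σ)²/Z`. (theory seat Sketch9 Part N) [folklore] -/
def wmean (a : (V → Fin 2) → ℝ) (f : (V → Fin 2) → ℝ) : ℝ := wsum a f / wnorm a

/-- One-point density `ρ_u = μ(n_u)`. (theory seat Sketch9 Part N) [folklore] -/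
def dens (a : (V → Fin 2) → ℝ) (u : V) : ℝ := wmean a (fun σ => occ σ u)

/-- Truncated pair correlation `c(u,v) = μ(n_u n_v) − ρ_u ρ_v`. (theory seat Sketch9 Part N) [folklore] -/
def corr2 (a : (V → Fin 2) → ℝ) (u v : V) : ℝ :=
  wmean a (fun σ => occ σ u * occ σ v) - dens a u * dens a v

/-- Fully truncated (Ursell) three-point function `u₃(u,v,w)`. (theory seat Sketch9 Part N) [folklore] -/
def ucorr3 (a : (V → Fin 2) → ℝ) (u v w : V) : ℝ :=
  wmean a (fun σ => occ σ u * occ σ v * occ σ w) - dens a u * dens a v * dens a w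
    - dens a u * corr2 a v w - dens a v * corr2 a u w - dens a w * corr2 a u v

/-- Particle–hole probability `μ(n_x (1 − n_y))` (`= a_{xy}/Z`). (theory seat Sketch9 Part N) [folklore] -/
def probPH (a : (V → Fin 2) → ℝ) (x y : V) : ℝ := wmean a (fun σ => occ σ x * (1 - occ σ y))

/-- `a_{xy} = Σ_σ a² n_x (1 − n_y)` (`x ≠ y`). (theory seat Sketch9 Part N) [folklore] -/
theorem pairMass_eq_wsum (a : (V → Fin 2) → ℝ) (x y : V) (hxy : x ≠ y) :
    pairMass a x y = wsum a (fun σ => occ σ x * (1 - occ σ y)) := by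
  unfold pairMass wsum
  rw [sum_template_eq_sum_config (fun σ => a σ ^ 2) x y hxy]
  refine Finset.sum_congr rfl fun σ _ => ?_
  unfold occ
  by_cases hx : σ x = 0 <;> by_cases hy : σ y = 0 <;>
    simp [hx, hy, fin2_eq_one_iff_ne_zero]

/-- `condOcc · a_{xy} = Σ_σ a² n_x (1 − n_y) n_z` for `z ≠ x`. (theory seat Sketch9 Part N) [folklore] -/
theorem condOcc_mul_pairMass (a : (V → Fin 2) → ℝ) (x y z : V) (hxy : x ≠ y) (hzx : z ≠ x)
    (hpm : pairMass a x y ≠ 0) :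
    condOcc a x y z * pairMass a x y = wsum a (fun σ => occ σ x * (1 - occ σ y) * occ σ z) := by
  unfold condOcc
  have : ∀ τ : V → Fin 2, teleLaw a x y τ * occ τ z
      = (if τ x = 1 ∧ τ y = 1 then a (Function.update τ x 0) ^ 2 * occ (Function.update τ x 0) z else 0)
          / pairMass a x y := by
    intro τ
    unfold teleLaw
    by_cases h : τ x = 1 ∧ τ y = 1
    · rw [if_pos h, if_pos h, occ_update τ x h.1 z, if_neg hzx, add_zero]; ring
    · rw [if_neg h, if_neg h]; simp
  simp_rw [this]
  rw [← Finset.sum_div, div_mul_cancel₀ _ hpm,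
    sum_template_eq_sum_config (fun σ => a σ ^ 2 * occ σ z) x y hxy]
  unfold wsum
  refine Finset.sum_congr rfl fun σ _ => ?_
  unfold occ
  by_cases hx : σ x = 0 <;> by_cases hy : σ y = 0 <;> by_cases hz : σ z = 0 <;>
    simp [hx, hy, hz, fin2_eq_one_iff_ne_zero]

/-- `wsum` is subtractive. [folklore] -/
theorem wsum_sub (a : (V → Fin 2) → ℝ) (f g : (V → Fin 2) → ℝ) :
    wsum a (fun σ => f σ - g σ) = wsum a f - wsum a g := by
  unfold wsum; rw [← Finset.sum_sub_distrib]; refine Finset.sum_congr rfl fun σ _ => ?_; ring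

/-- `wsum` is additive. [folklore] -/
theorem wsum_add (a : (V → Fin 2) → ℝ) (f g : (V → Fin 2) → ℝ) :
    wsum a (fun σ => f σ + g σ) = wsum a f + wsum a g := by
  unfold wsum; rw [← Finset.sum_add_distrib]; refine Finset.sum_congr rfl fun σ _ => ?_; ring

/-- `wsum` is homogeneous. [folklore] -/
theorem wsum_smul (a : (V → Fin 2) → ℝ) (t : ℝ) (f : (V → Fin 2) → ℝ) :
    wsum a (fun σ => t * f σ) = t * wsum a f := by
  unfold wsum; rw [Finset.mul_sum]; refine Finset.sum_congr rfl fun σ _ => ?_; ring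

/-- `wsum` of a constant. [folklore] -/
theorem wsum_const (a : (V → Fin 2) → ℝ) (t : ℝ) : wsum a (fun _ => t) = t * wnorm a := by
  unfold wsum wnorm; rw [Finset.mul_sum]; refine Finset.sum_congr rfl fun σ _ => ?_; ring

/-- `Z ≥ 0`. [folklore] -/
theorem wnorm_nonneg (a : (V → Fin 2) → ℝ) : 0 ≤ wnorm a := Finset.sum_nonneg fun _ _ => sq_nonneg _

/-- `wmean` is subtractive. [folklore] -/
theorem wmean_sub (a : (V → Fin 2) → ℝ) (f g : (V → Fin 2) → ℝ) :
    wmean a (fun σ => f σ - g σ) = wmean a f - wmean a g := by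
  unfold wmean; rw [wsum_sub, sub_div]

/-- `wmean` is additive. [folklore] -/
theorem wmean_add (a : (V → Fin 2) → ℝ) (f g : (V → Fin 2) → ℝ) :
    wmean a (fun σ => f σ + g σ) = wmean a f + wmean a g := by
  unfold wmean; rw [wsum_add, add_div]

/-- `wmean` is homogeneous. [folklore] -/
theorem wmean_smul (a : (V → Fin 2) → ℝ) (t : ℝ) (f : (V → Fin 2) → ℝ) :
    wmean a (fun σ => t * f σ) = t * wmean a f := by
  unfold wmean; rw [wsum_smul, mul_div_assoc]

/-- `wmean` of a constant (`Z ≠ 0`). [folklore] -/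
theorem wmean_const (a : (V → Fin 2) → ℝ) (t : ℝ) (hZ : wnorm a ≠ 0) : wmean a (fun _ => t) = t := by
  unfold wmean; rw [wsum_const, mul_div_assoc, div_self hZ, mul_one]

/-- `wmean` respects pointwise equality. [folklore] -/
theorem wmean_congr (a : (V → Fin 2) → ℝ) {f g : (V → Fin 2) → ℝ} (h : ∀ σ, f σ = g σ) :
    wmean a f = wmean a g := by
  unfold wmean wsum
  rw [show (fun σ => a σ ^ 2 * f σ) = (fun σ => a σ ^ 2 * g σ) from funext fun σ => by rw [h σ]]

/-- `wmean` of a non-negative function is non-negative. [folklore] -/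
theorem wmean_nonneg (a : (V → Fin 2) → ℝ) {f : (V → Fin 2) → ℝ} (hf : ∀ σ, 0 ≤ f σ) : 0 ≤ wmean a f := by
  unfold wmean wsum
  exact div_nonneg (Finset.sum_nonneg fun σ _ => mul_nonneg (sq_nonneg _) (hf σ)) (wnorm_nonneg a)

/-- `wmean` is monotone. [folklore] -/
theorem wmean_mono (a : (V → Fin 2) → ℝ) {f g : (V → Fin 2) → ℝ} (h : ∀ σ, f σ ≤ g σ) :
    wmean a f ≤ wmean a g := by
  have := wmean_nonneg a (f := fun σ => g σ - f σ) (fun σ => sub_nonneg.mpr (h σ))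
  rw [wmean_sub] at this; linarith

/-- `wmean f ≤ B` if `f ≤ B` pointwise (`Z ≠ 0`). [folklore] -/
theorem wmean_le_of_le (a : (V → Fin 2) → ℝ) {f : (V → Fin 2) → ℝ} (B : ℝ) (hZ : wnorm a ≠ 0)
    (h : ∀ σ, f σ ≤ B) : wmean a f ≤ B := by
  have := wmean_mono a (g := fun _ => B) h
  rwa [wmean_const a B hZ] at this

/-- `wmean` commutes with finite sums. [folklore] -/
theorem wmean_finset_sum (a : (V → Fin 2) → ℝ) {ι : Type} (s : Finset ι) (f : ι → (V → Fin 2) → ℝ) :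
    wmean a (fun σ => ∑ i ∈ s, f i σ) = ∑ i ∈ s, wmean a (f i) := by
  unfold wmean wsum
  rw [← Finset.sum_div]
  congr 1
  rw [Finset.sum_comm]
  exact Finset.sum_congr rfl fun σ _ => Finset.mul_sum _ _ _

/-- `μ(n_x(1−n_y)) = a_{xy}/Z`. (theory seat Sketch9 Part N) [folklore] -/
theorem probPH_eq (a : (V → Fin 2) → ℝ) (x y : V) (hxy : x ≠ y) : probPH a x y = pairMass a x y / wnorm a := by
  unfold probPH wmean; rw [pairMass_eq_wsum a x y hxy]

/-- **S4 IDENTITY (PROVED).** The two-defect cloud of R8b in terms of unconditioned truncated correlations: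
`P[n_z = 1 | x occupied, y empty] − ρ_z = ((1 − ρ_y) c(z,x) − ρ_x c(z,y) − u₃(z,x,y)) / μ(n_x(1 − n_y))` (`z ≠ x`).
(theory seat Sketch9 Part N `condOcc_sub_dens_eq`, memo ROTOR-THEORY-9 §135(q)) [folklore] -/
theorem condOcc_sub_dens_eq (a : (V → Fin 2) → ℝ) (x y z : V) (hxy : x ≠ y) (hzx : z ≠ x)
    (hZ : wnorm a ≠ 0) (hpm : pairMass a x y ≠ 0) :
    condOcc a x y z - dens a z
      = ((1 - dens a y) * corr2 a z x - dens a x * corr2 a z y - ucorr3 a z x y) / probPH a x y := by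
  have hD : probPH a x y ≠ 0 := by rw [probPH_eq a x y hxy]; exact div_ne_zero hpm hZ
  have hcond : condOcc a x y z = wmean a (fun σ => occ σ x * (1 - occ σ y) * occ σ z) / probPH a x y := by
    rw [probPH_eq a x y hxy]
    unfold wmean
    rw [← condOcc_mul_pairMass a x y z hxy hzx hpm]
    field_simp
  have h3 : wmean a (fun σ => occ σ x * (1 - occ σ y) * occ σ z)
      = wmean a (fun σ => occ σ z * occ σ x) - wmean a (fun σ => occ σ z * occ σ x * occ σ y) := by
    rw [← wmean_sub]; exact wmean_congr a fun σ => by ring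
  have hP : probPH a x y = dens a x - wmean a (fun σ => occ σ x * occ σ y) := by
    unfold probPH dens; rw [← wmean_sub]; exact wmean_congr a fun σ => by ring
  rw [hcond, h3]
  unfold ucorr3 corr2
  rw [hP] at hD ⊢
  field_simp
  ring

omit [Fintype V] [DecidableEq V] in
/-- `0 ≤ n_u ≤ 1`. [folklore] -/
theorem occ_mem_unit (σ : V → Fin 2) (u : V) : 0 ≤ occ σ u ∧ occ σ u ≤ 1 := by
  unfold occ; split_ifs <;> norm_num

/-- `ρ_u ≥ 0`. [folklore] -/
theorem dens_nonneg (a : (V → Fin 2) → ℝ) (u : V) : 0 ≤ dens a u :=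
  wmean_nonneg a fun σ => (occ_mem_unit σ u).1

/-- `ρ_u ≤ 1`. [folklore] -/
theorem dens_le_one (a : (V → Fin 2) → ℝ) (u : V) : dens a u ≤ 1 := by
  unfold dens wmean wsum wnorm
  by_cases hZ : ∑ σ, a σ ^ 2 = 0
  · rw [hZ, div_zero]; norm_num
  · have hZpos : 0 < ∑ σ, a σ ^ 2 := lt_of_le_of_ne (Finset.sum_nonneg fun σ _ => sq_nonneg _) (Ne.symm hZ)
    rw [div_le_one hZpos]
    exact Finset.sum_le_sum fun σ _ => by nlinarith [sq_nonneg (a σ), (occ_mem_unit σ u).2]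

/-- **S4 BOUND (PROVED).** Decay of `c`, `u₃` and a particle–hole floor give the R8b cloud bound with `m = ρ_z`:
`|condOcc(z) − ρ_z| ≤ (2K/c₀)(ω_x + ω_y)`. (theory seat Sketch9 Part N `abs_condOcc_sub_dens_le`) [folklore] -/
theorem abs_condOcc_sub_dens_le (a : (V → Fin 2) → ℝ) (x y z : V) (hxy : x ≠ y) (hzx : z ≠ x)
    (hZ : wnorm a ≠ 0) (hpm : pairMass a x y ≠ 0) (K ωx ωy c₀ : ℝ) (hc₀ : 0 < c₀)
    (hD : c₀ ≤ probPH a x y) (h2x : |corr2 a z x| ≤ K * ωx) (h2y : |corr2 a z y| ≤ K * ωy)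
    (h3 : |ucorr3 a z x y| ≤ K * (ωx + ωy)) :
    |condOcc a x y z - dens a z| ≤ 2 * K / c₀ * (ωx + ωy) := by
  rw [condOcc_sub_dens_eq a x y z hxy hzx hZ hpm, abs_div, abs_of_pos (lt_of_lt_of_le hc₀ hD)]
  have hρx0 := dens_nonneg a x; have hρx1 := dens_le_one a x
  have hρy0 := dens_nonneg a y; have hρy1 := dens_le_one a y
  have hnum : |(1 - dens a y) * corr2 a z x - dens a x * corr2 a z y - ucorr3 a z x y| ≤ 2 * K * (ωx + ωy) := by
    have t1 : |(1 - dens a y) * corr2 a z x| ≤ K * ωx := by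
      rw [abs_mul, abs_of_nonneg (by linarith)]
      calc (1 - dens a y) * |corr2 a z x| ≤ 1 * |corr2 a z x| :=
            mul_le_mul_of_nonneg_right (by linarith) (abs_nonneg _)
        _ ≤ K * ωx := by rw [one_mul]; exact h2x
    have t2 : |dens a x * corr2 a z y| ≤ K * ωy := by
      rw [abs_mul, abs_of_nonneg hρx0]
      calc dens a x * |corr2 a z y| ≤ 1 * |corr2 a z y| :=
            mul_le_mul_of_nonneg_right hρx1 (abs_nonneg _)
        _ ≤ K * ωy := by rw [one_mul]; exact h2y
    calc |(1 - dens a y) * corr2 a z x - dens a x * corr2 a z y - ucorr3 a z x y|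
        ≤ |(1 - dens a y) * corr2 a z x - dens a x * corr2 a z y| + |ucorr3 a z x y| := abs_sub _ _
      _ ≤ |(1 - dens a y) * corr2 a z x| + |dens a x * corr2 a z y| + |ucorr3 a z x y| := by
          linarith [abs_sub ((1 - dens a y) * corr2 a z x) (dens a x * corr2 a z y)]
      _ ≤ K * ωx + K * ωy + K * (ωx + ωy) := by linarith
      _ = 2 * K * (ωx + ωy) := by ring
  have hKω : 0 ≤ 2 * K * (ωx + ωy) := by nlinarith [abs_nonneg (corr2 a z x), abs_nonneg (corr2 a z y)]
  have hDpos : 0 < probPH a x y := lt_of_lt_of_le hc₀ hD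
  calc |(1 - dens a y) * corr2 a z x - dens a x * corr2 a z y - ucorr3 a z x y| / probPH a x y
      ≤ 2 * K * (ωx + ωy) / probPH a x y := div_le_div_of_nonneg_right hnum hDpos.le
    _ ≤ 2 * K * (ωx + ωy) / c₀ := div_le_div_of_nonneg_left hKω hc₀ hD
    _ = 2 * K / c₀ * (ωx + ωy) := by ring

/-- `condOcc(x,y,x) = 0`: the template is empty at `x`. [folklore] -/
theorem condOcc_self_left (a : (V → Fin 2) → ℝ) (x y : V) : condOcc a x y x = 0 := by
  unfold condOcc
  refine Finset.sum_eq_zero fun τ _ => ?_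
  unfold teleLaw occ
  by_cases h : τ x = 1 ∧ τ y = 1
  · have : τ x ≠ 0 := by rw [h.1]; decide
    simp [this]
  · rw [if_neg h, zero_mul]

/-- `condOcc(x,y,y) = 0`: the template is empty at `y`. [folklore] -/
theorem condOcc_self_right (a : (V → Fin 2) → ℝ) (x y : V) : condOcc a x y y = 0 := by
  unfold condOcc
  refine Finset.sum_eq_zero fun τ _ => ?_
  unfold teleLaw occ
  by_cases h : τ x = 1 ∧ τ y = 1
  · have : τ y ≠ 0 := by rw [h.2]; decide
    simp [this]
  · rw [if_neg h, zero_mul]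

/-- `μ(n_x(1−n_y)) = ρ_x(1−ρ_y) − c(x,y)`. (theory seat Sketch9 Part N′) [folklore] -/
theorem probPH_eq_dens_sub (a : (V → Fin 2) → ℝ) (x y : V) :
    probPH a x y = dens a x * (1 - dens a y) - corr2 a x y := by
  unfold probPH corr2 dens
  rw [show (fun σ : V → Fin 2 => occ σ x * (1 - occ σ y)) = (fun σ => occ σ x - occ σ x * occ σ y) from
    funext fun σ => by ring, wmean_sub]
  ring

/-- `Σ_z ρ_z = μ(Σ_z n_z)`. (theory seat Sketch9 Part N′) [folklore] -/
theorem sum_dens_eq (a : (V → Fin 2) → ℝ) : ∑ z, dens a z = wmean a (fun σ => ∑ z, occ σ z) := by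
  unfold dens wmean wsum
  rw [← Finset.sum_div]
  congr 1
  rw [Finset.sum_comm]
  refine Finset.sum_congr rfl fun σ _ => ?_
  rw [Finset.mul_sum]

end SheetCorrelations

end Summit.HubbardSuperconductivity.HubbardSuperconductivity.Theorems.AnisotropyChord.InsertionEntropy
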